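import Summits.CriticalPhenomena.PercolationContinuityZ3.Theorems.PercNearOneGluingNoHeavyLowerTailSahiTwoLevelVariationalMoves
import Summits.CriticalPhenomena.PercolationContinuityZ3.Theorems.PercNearOneGluingNoHeavyLowerTailSahiTwoLevelVariationalEquiv
import Mathlib.Tactic.Linarith
import Mathlib.Tactic.Ring
import HarnessLib

/-!
# The TOP-ABSORBING face of the two-level TOP law: if one top contains the meet of the other two, `T⁺ ≥ 0`
# — and the reduction of `SahiTwoLevelPlus` (hence Kahn's Conjecture 5) to TOP-ANTICHAIN nested pairs

Support file of the one-cut programme (crux `NoHeavyLowerTail`, stmt-CriticalPhenomena-4575; master-family line P2 = Sahi's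
algebraic route, seat `prim-masterthm-p2` gen 21; memo `run/shared/lean/prim/prim-masterthm/FROM-prim-masterthm-p2-g21-TOP-ABSORBING.md`).
No definition, no sorry; axioms standard.  (The typed restriction `TopAntichainPlus` of the law to top-antichain pairs and the
equivalence `SahiTwoLevelPlus ↔ TopAntichainPlus` are in the companion file `…SahiTwoLevelTopAntichain`.)

SETTING (`…SahiTwoLevelC3`, `…SahiTwoLevelVariational{,Moves,Equiv}`).  `μ = prodBernoulli q` on a finite cube; a nested pair
`H_i ⊆ G_i` (`i = 0,1,2`) of triples of increasing events; the TOP two-level form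
`T⁺(G,H) = topForm q G H = twoLevelForm μ G H − ∏_i (μ G_i − μ H_i)` (`= 3β₂ − β₃` of the fibre cubic with sections `(G,H)`);
`SahiTwoLevelPlus` (`T⁺ ≥ 0` at every nested pair) implies Kahn's Conjecture 5 (`kahnConjecture_of_sahiTwoLevelPlus`).

THE OBSERVATION (two lemmas already in the tree, composed).  By the compact form `T⁺` is affine in each of the six events and the
point coefficient of the top `G₀` is `≤ 0` OFF `G₁ ∩ G₂` — move **(T+)** `topForm_top_union_le` (P2 gen 20): adding to `G₀` any set
avoiding `G₁ ∩ G₂` does not increase `T⁺`.  If `G₁ ∩ G₂ ⊆ G₀` the whole complement of `G₀` avoids `G₁ ∩ G₂`, so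
`T⁺(G,H) ≥ T⁺((Ω, G₁, G₂), H)`; and a pair whose slot-`0` top is the sure event has INDEPENDENT TOPS (`Ω` is determined by no
coordinate), where `T⁺ ≥ 0` is bnk-2's theorem `SahiTwoLevelIndep.twoLevelPlus_nonneg_of_determinedBy` (gen 16).  Hence:

* **`topForm_nonneg_of_topAbsorbing₀`** — `G₁ ∩ G₂ ⊆ G₀ ⟹ T⁺(G,H) ≥ 0` for ALL nested increasing bottoms, UNCONDITIONALLY (Harris +
  independent tops; no `E_3 ≥ 0` hypothesis); slots `1`, `2` by rotation (`…₁`, `…₂`), and `twoLevelPlus_nonneg_of_topAbsorbing` in the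
  native form of `SahiTwoLevelPlus`.  In terms of triples: the top law holds along a coordinate `e` of an increasing triple `U` whenever
  some `1`-section contains the meet of the other two (`U_i^{e←1} ⊇ U_j^{e←1} ∩ U_k^{e←1}`) — the two-level companion of lane P3's
  value-level "absorbing head" theorem (`SahiAbsorbed.sahiE_three_setInd_nonneg_of_comparable` & co.), here at the TOP level only and
  with the bottoms free.
* **MARGIN on the doubly absorbing face** (`le_topForm_of_absorbing₀`): if also `H₁ ∩ H₂ ⊆ H₀` then (move (B+) to `H₀ = Ω` as well)
  `T⁺(G,H) ≥ μ(H₁H₂) + μ(G₁G₂) − μ(G₁)μ(H₂) − μ(G₂)μ(H₁) ≥ (μG₁ − μH₁)(μG₂ − μH₂)` (`prod_sub_le_topForm_of_absorbing₀`; tight: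
  equality at slot `0` `= (Ω,Ω)`).
* CONSEQUENCE (companion file `…SahiTwoLevelTopAntichain`): the two-level top law — hence Kahn's Conjecture 5 / Sahi's `C_3` on product
  measures — reduces to (indeed is equivalent to) its restriction to nested pairs whose TOP triple is 3-wise non-absorbing
  (`G_j ∩ G_k ⊄ G_i` for every `i`).

CENSUS of what this face adds (this seat, exact/float cross-checked, `code/census_faces.py`; "old" = the union of the proved faces packaged
in `SahiTwoLevelVariational.InSolvedFace`: W-face, costless-inside, an independent pair of tops, `κ₃(G) ≥ 0`, one idle slot with
nonnegative bracket, over the three slot rotations):  `{0,1}^3`, ALL 4 741 632 ordered nested sextuples: old faces cover 95.7 % (`q ≡ ½`)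
/ 95.5 % (`q = (.3,.5,.7)`), the top-absorbing face ALONE 99.48 %, the union 99.92 %; the 3 558 / 3 564 uncovered sextuples ALL have the
co-sunflower tops `(x₀∨x₁, x₀∨x₂, x₁∨x₂)` (lane P1's class `SahiCoSunflowerTwoLevel.CoSunflowerTwoLevel`), `T⁺ ≥ 0.0359` there.
`{0,1}^4`, 4·10⁵ uniform random nested sextuples: old 71.1 % / 73.0 %, top-absorbing alone 92.4 %, union 97.2 % / 97.3 %.  Of the
168³ ordered TOP triples on `{0,1}^4`, 325 926 are 3-wise non-absorbing, of which 270 720 (5.7 % of all) have pairwise dependent tops and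
`κ₃ < 0` at `q ≡ ½` (2 146 classes mod symmetry) — the residual TOP classes of the law.

HONEST LABEL: two proved lemmas composed and a margin identity; nothing here asserts `SahiTwoLevelPlus` or Kahn's Conjecture 5
(both OPEN). [this work]
-/

noncomputable section

open scoped Classical

namespace Summit.CriticalPhenomena.PercolationContinuityZ3.Theorems

namespace SahiTwoLevelVariational

open Finset Function MeasureTheory
open Literature.Combinatorics.Sahi2008
open Literature.Probability.LatticeModels (prodBernoulli prodBernoulli_harris sahiE3)
open Literature.Probability.Percolation (DeterminedBy determinedBy_iff)

variable {κ : Type} [Fintype κ]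

/-! ### 1. Filling the top of slot `0` -/

/-- **Filling the top (move (T+) to the sure event).**  If `G₁ ∩ G₂ ⊆ G₀` then replacing `G₀` by the sure event does not increase
`T⁺`: `T⁺((Ω, G₁, G₂), H) ≤ T⁺(G, H)` (bottoms `H₁ ⊆ G₁`, `H₂ ⊆ G₂` increasing; Harris). [this work] -/
theorem topForm_top₀_univ_le (q : κ → unitInterval) (G H : Fin 3 → Set (Set κ))
    (hH1 : IsUpperSet (H 1)) (hH2 : IsUpperSet (H 2)) (hH1G : H 1 ⊆ G 1) (hH2G : H 2 ⊆ G 2)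
    (habs : G 1 ∩ G 2 ⊆ G 0) :
    topForm q ![(Set.univ : Set (Set κ)), G 1, G 2] H ≤ topForm q G H := by
  have hA : (G 0)ᶜ ∩ G 1 ∩ G 2 = ∅ :=
    Set.subset_empty_iff.1 fun ω hω => (hω.1.1 (habs ⟨hω.1.2, hω.2⟩)).elim
  have h := topForm_top_union_le q H (G 0) (G 0)ᶜ (G 1) (G 2) hH1 hH2 hH1G hH2G disjoint_compl_right hA
  have hG : (![G 0, G 1, G 2] : Fin 3 → Set (Set κ)) = G := by funext i; fin_cases i <;> rfl
  rwa [Set.union_compl_self, hG] at h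

/-- **A sure top puts the pair in the independent-tops face**: `G₀ = Ω ⟹ T⁺(G,H) ≥ 0` (bnk-2's
`SahiTwoLevelIndep.twoLevelPlus_nonneg_of_determinedBy` with `T = univ`: `Ω` is determined by no coordinate). [this work] -/
theorem topForm_nonneg_of_top₀_univ (q : κ → unitInterval) (G H : Fin 3 → Set (Set κ))
    (hG : ∀ i, IsUpperSet (G i)) (hH : ∀ i, IsUpperSet (H i)) (hHG : ∀ i, H i ⊆ G i)
    (h0 : G 0 = Set.univ) : 0 ≤ topForm q G H := by
  rw [topForm_def]
  refine SahiTwoLevelIndep.twoLevelPlus_nonneg_of_determinedBy q Finset.univ G H hG hH hHG ?_ (determinedBy_univ _)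
  rw [h0]
  exact Literature.Probability.Percolation.determinedBy_univ _

/-! ### 2. The top-absorbing face -/

/-- **THE TOP-ABSORBING FACE (slot `0`).**  For a nested pair of triples of increasing events under a product measure on a finite cube:
if `G₁ ∩ G₂ ⊆ G₀` then `T⁺(G,H) ≥ 0` — unconditionally, for all nested increasing bottoms. [this work] -/
theorem topForm_nonneg_of_topAbsorbing₀ (q : κ → unitInterval) (G H : Fin 3 → Set (Set κ))
    (hG : ∀ i, IsUpperSet (G i)) (hH : ∀ i, IsUpperSet (H i)) (hHG : ∀ i, H i ⊆ G i)
    (habs : G 1 ∩ G 2 ⊆ G 0) : 0 ≤ topForm q G H := by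
  refine le_trans ?_ (topForm_top₀_univ_le q G H (hH 1) (hH 2) (hHG 1) (hHG 2) habs)
  refine topForm_nonneg_of_top₀_univ q _ H ?_ hH ?_ rfl
  · intro i; fin_cases i
    · exact isUpperSet_univ
    · exact hG 1
    · exact hG 2
  · intro i; fin_cases i
    · exact Set.subset_univ _
    · exact hHG 1
    · exact hHG 2

omit [Fintype κ] in
/-- Up-sets are preserved by the slot rotation. [this work] -/
theorem isUpperSet_rot {X : Fin 3 → Set (Set κ)} (hX : ∀ i, IsUpperSet (X i)) : ∀ i, IsUpperSet (rot X i) := by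
  intro i; fin_cases i
  · exact hX 1
  · exact hX 2
  · exact hX 0

omit [Fintype κ] in
/-- Nestedness is preserved by the slot rotation. [this work] -/
theorem rot_subset_rot {X Y : Fin 3 → Set (Set κ)} (hXY : ∀ i, Y i ⊆ X i) : ∀ i, rot Y i ⊆ rot X i := by
  intro i; fin_cases i
  · exact hXY 1
  · exact hXY 2
  · exact hXY 0

/-- **The top-absorbing face, slot `1`**: `G₂ ∩ G₀ ⊆ G₁ ⟹ T⁺(G,H) ≥ 0`. [this work] -/
theorem topForm_nonneg_of_topAbsorbing₁ (q : κ → unitInterval) (G H : Fin 3 → Set (Set κ))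
    (hG : ∀ i, IsUpperSet (G i)) (hH : ∀ i, IsUpperSet (H i)) (hHG : ∀ i, H i ⊆ G i)
    (habs : G 2 ∩ G 0 ⊆ G 1) : 0 ≤ topForm q G H := by
  rw [← topForm_rot]
  exact topForm_nonneg_of_topAbsorbing₀ q (rot G) (rot H) (isUpperSet_rot hG) (isUpperSet_rot hH) (rot_subset_rot hHG) habs

/-- **The top-absorbing face, slot `2`**: `G₀ ∩ G₁ ⊆ G₂ ⟹ T⁺(G,H) ≥ 0`. [this work] -/
theorem topForm_nonneg_of_topAbsorbing₂ (q : κ → unitInterval) (G H : Fin 3 → Set (Set κ))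
    (hG : ∀ i, IsUpperSet (G i)) (hH : ∀ i, IsUpperSet (H i)) (hHG : ∀ i, H i ⊆ G i)
    (habs : G 0 ∩ G 1 ⊆ G 2) : 0 ≤ topForm q G H := by
  rw [← topForm_rot, ← topForm_rot]
  exact topForm_nonneg_of_topAbsorbing₀ q (rot (rot G)) (rot (rot H)) (isUpperSet_rot (isUpperSet_rot hG))
    (isUpperSet_rot (isUpperSet_rot hH)) (rot_subset_rot (rot_subset_rot hHG)) habs

/-- **The top-absorbing face in the native form of `SahiTwoLevelPlus`**: if some top contains the meet of the other two then
`0 ≤ twoLevelForm μ G H − ∏_i (μ G_i − μ H_i)`. [this work] -/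
theorem twoLevelPlus_nonneg_of_topAbsorbing (q : κ → unitInterval) (G H : Fin 3 → Set (Set κ))
    (hG : ∀ i, IsUpperSet (G i)) (hH : ∀ i, IsUpperSet (H i)) (hHG : ∀ i, H i ⊆ G i)
    (habs : G 1 ∩ G 2 ⊆ G 0 ∨ G 2 ∩ G 0 ⊆ G 1 ∨ G 0 ∩ G 1 ⊆ G 2) :
    0 ≤ twoLevelForm (fun A => (prodBernoulli q).real A) G H
          - ∏ i, ((prodBernoulli q).real (G i) - (prodBernoulli q).real (H i)) := by
  rw [← topForm_def]
  rcases habs with h | h | h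
  · exact topForm_nonneg_of_topAbsorbing₀ q G H hG hH hHG h
  · exact topForm_nonneg_of_topAbsorbing₁ q G H hG hH hHG h
  · exact topForm_nonneg_of_topAbsorbing₂ q G H hG hH hHG h

/-! ### 3. The margin on the doubly absorbing face -/

/-- **Filling the bottom (move (B+) to the sure event).**  If `H₁ ∩ H₂ ⊆ H₀` then replacing `H₀` by the sure event does not increase
`T⁺`: `T⁺(G, (Ω, H₁, H₂)) ≤ T⁺(G, H)` (tops `G₁, G₂` increasing; Harris).  (The resulting slot-`0` pair `(Ω, G₀)` need not be nested;
`T⁺` is a polynomial in the moments and the inequality is unconditional.) [this work] -/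
theorem topForm_bottom₀_univ_le (q : κ → unitInterval) (G H : Fin 3 → Set (Set κ))
    (hG1 : IsUpperSet (G 1)) (hG2 : IsUpperSet (G 2)) (habs : H 1 ∩ H 2 ⊆ H 0) :
    topForm q G ![(Set.univ : Set (Set κ)), H 1, H 2] ≤ topForm q G H := by
  have hA : (H 0)ᶜ ∩ H 1 ∩ H 2 = ∅ :=
    Set.subset_empty_iff.1 fun ω hω => (hω.1.1 (habs ⟨hω.1.2, hω.2⟩)).elim
  have h := topForm_bottom_union_le q G (H 0) (H 0)ᶜ (H 1) (H 2) hG1 hG2 disjoint_compl_right hA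
  have hH : (![H 0, H 1, H 2] : Fin 3 → Set (Set κ)) = H := by funext i; fin_cases i <;> rfl
  rwa [Set.union_compl_self, hH] at h

omit [Fintype κ] in
/-- **`T⁺` with slot `0` the sure pair**: `T⁺((Ω,G₁,G₂),(Ω,H₁,H₂)) = μ(H₁H₂) + μ(G₁G₂) − μ(G₁)μ(H₂) − μ(G₂)μ(H₁)`. [this work] -/
theorem topForm_slot₀_univ (q : κ → unitInterval) (G₁ G₂ H₁ H₂ : Set (Set κ)) :
    topForm q ![(Set.univ : Set (Set κ)), G₁, G₂] ![(Set.univ : Set (Set κ)), H₁, H₂] =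
      (prodBernoulli q).real (H₁ ∩ H₂) + (prodBernoulli q).real (G₁ ∩ G₂)
        - (prodBernoulli q).real G₁ * (prodBernoulli q).real H₂ - (prodBernoulli q).real G₂ * (prodBernoulli q).real H₁ := by
  rw [topForm_eq_compact]
  simp only [Matrix.cons_val_zero, Matrix.cons_val_one, Matrix.cons_val_two, Matrix.head_cons, Matrix.tail_cons,
    Set.univ_inter, probReal_univ]
  ring

/-- **MARGIN ON THE DOUBLY ABSORBING FACE.**  If `G₁ ∩ G₂ ⊆ G₀` and `H₁ ∩ H₂ ⊆ H₀` then
`T⁺(G,H) ≥ μ(H₁H₂) + μ(G₁G₂) − μ(G₁)μ(H₂) − μ(G₂)μ(H₁)` (tight: equality when slot `0` is the sure pair). [this work] -/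
theorem le_topForm_of_absorbing₀ (q : κ → unitInterval) (G H : Fin 3 → Set (Set κ))
    (hG : ∀ i, IsUpperSet (G i)) (hH : ∀ i, IsUpperSet (H i)) (hHG : ∀ i, H i ⊆ G i)
    (habsG : G 1 ∩ G 2 ⊆ G 0) (habsH : H 1 ∩ H 2 ⊆ H 0) :
    (prodBernoulli q).real (H 1 ∩ H 2) + (prodBernoulli q).real (G 1 ∩ G 2)
        - (prodBernoulli q).real (G 1) * (prodBernoulli q).real (H 2) - (prodBernoulli q).real (G 2) * (prodBernoulli q).real (H 1)
      ≤ topForm q G H := by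
  have h1 := topForm_top₀_univ_le q G H (hH 1) (hH 2) (hHG 1) (hHG 2) habsG
  have h2 := topForm_bottom₀_univ_le q ![(Set.univ : Set (Set κ)), G 1, G 2] H (hG 1) (hG 2) habsH
  have h3 := topForm_slot₀_univ q (G 1) (G 2) (H 1) (H 2)
  linarith

/-- **Consequently `T⁺(G,H) ≥ (μG₁ − μH₁)(μG₂ − μH₂) ≥ 0` on the doubly absorbing face** (Harris for `H₁,H₂` and for `G₁,G₂`);
in particular the margin law `T⁺ ≥ min_k (μG_k − μH_k)·Cov(G_i,G_j)` holds there (`T⁺ ≥ Cov(G₁,G₂)`). [this work] -/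
theorem prod_sub_le_topForm_of_absorbing₀ (q : κ → unitInterval) (G H : Fin 3 → Set (Set κ))
    (hG : ∀ i, IsUpperSet (G i)) (hH : ∀ i, IsUpperSet (H i)) (hHG : ∀ i, H i ⊆ G i)
    (habsG : G 1 ∩ G 2 ⊆ G 0) (habsH : H 1 ∩ H 2 ⊆ H 0) :
    ((prodBernoulli q).real (G 1) - (prodBernoulli q).real (H 1)) * ((prodBernoulli q).real (G 2) - (prodBernoulli q).real (H 2))
        + ((prodBernoulli q).real (G 1 ∩ G 2) - (prodBernoulli q).real (G 1) * (prodBernoulli q).real (G 2))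
      ≤ topForm q G H := by
  have h := le_topForm_of_absorbing₀ q G H hG hH hHG habsG habsH
  have hH12 := prodBernoulli_harris q (hH 1) (hH 2) MeasurableSet.of_discrete MeasurableSet.of_discrete
  nlinarith [hH12]

/-! ### 4. Appended (gen 21, later): the PROJECTIVE-ABSORBING face — enlarging a top to an event independent of a partner top -/

/-- **THE PROJECTIVE-ABSORBING FACE (slot `0`; generalises the top-absorbing face).**  If the slot-`0` top can be enlarged, WITHOUT
meeting `G₁ ∩ G₂`, to an increasing event `Y ⊇ G₀` determined by coordinates disjoint from a set `T` determining `G₁`, then `T⁺(G,H) ≥ 0`: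
move (T+) with `A = Y ∖ G₀`, then bnk-2's independent tops at `((Y, G₁, G₂), H)`.  The top-absorbing face is `Y = Ω`, `T = univ`; in general
the least candidate is the cylinder `Y = {ω | ω ∪ S ∈ G₀}`, `S ⊇` the coordinates of `G₁` (census, memo §4: this covers about a third of what
the older faces and the top-absorbing face leave open on `{0,1}^5`, `{0,1}^6`). [this work] -/
theorem topForm_nonneg_of_topExtension₀ (q : κ → unitInterval) (T : Finset κ) (G H : Fin 3 → Set (Set κ))
    (hG : ∀ i, IsUpperSet (G i)) (hH : ∀ i, IsUpperSet (H i)) (hHG : ∀ i, H i ⊆ G i)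
    (Y : Set (Set κ)) (hY : IsUpperSet Y) (hGY : G 0 ⊆ Y) (hYT : DeterminedBy Y (↑T : Set κ)ᶜ)
    (hG1T : DeterminedBy (G 1) (↑T : Set κ)) (havoid : (Y \ G 0) ∩ G 1 ∩ G 2 = ∅) :
    0 ≤ topForm q G H := by
  have h := topForm_top_union_le q H (G 0) (Y \ G 0) (G 1) (G 2) (hH 1) (hH 2) (hHG 1) (hHG 2) Set.disjoint_sdiff_right havoid
  have hG' : (![G 0, G 1, G 2] : Fin 3 → Set (Set κ)) = G := by funext i; fin_cases i <;> rfl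
  rw [Set.union_sdiff_cancel hGY, hG'] at h
  refine le_trans ?_ h
  rw [topForm_def]
  refine SahiTwoLevelIndep.twoLevelPlus_nonneg_of_determinedBy q T _ H ?_ hH ?_ hYT hG1T
  · intro i; fin_cases i
    · exact hY
    · exact hG 1
    · exact hG 2
  · intro i; fin_cases i
    · exact (hHG 0).trans hGY
    · exact hHG 1
    · exact hHG 2

/-- The projective-absorbing face with the roles of the two partners exchanged (`Y` independent of `G₂`). [this work] -/
theorem topForm_nonneg_of_topExtension₀' (q : κ → unitInterval) (T : Finset κ) (G H : Fin 3 → Set (Set κ))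
    (hG : ∀ i, IsUpperSet (G i)) (hH : ∀ i, IsUpperSet (H i)) (hHG : ∀ i, H i ⊆ G i)
    (Y : Set (Set κ)) (hY : IsUpperSet Y) (hGY : G 0 ⊆ Y) (hYT : DeterminedBy Y (↑T : Set κ)ᶜ)
    (hG2T : DeterminedBy (G 2) (↑T : Set κ)) (havoid : (Y \ G 0) ∩ G 1 ∩ G 2 = ∅) :
    0 ≤ topForm q G H := by
  -- swap slots 1 and 2: `T⁺` is symmetric (compact form), then apply the previous theorem
  have hswap : topForm q G H = topForm q ![G 0, G 2, G 1] ![H 0, H 2, H 1] := by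
    rw [topForm_eq_compact, topForm_eq_compact]
    simp only [Matrix.cons_val_zero, Matrix.cons_val_one, Matrix.cons_val_two, Matrix.head_cons, Matrix.tail_cons]
    rw [Set.inter_right_comm (H 0) (H 2) (H 1), Set.inter_right_comm (G 0) (G 2) (G 1), Set.inter_comm (H 2) (H 1),
      Set.inter_comm (G 2) (G 1)]
    ring
  rw [hswap]
  refine topForm_nonneg_of_topExtension₀ q T _ _ ?_ ?_ ?_ Y hY hGY hYT hG2T ?_
  · intro i; fin_cases i
    · exact hG 0
    · exact hG 2
    · exact hG 1
  · intro i; fin_cases i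
    · exact hH 0
    · exact hH 2
    · exact hH 1
  · intro i; fin_cases i
    · exact hHG 0
    · exact hHG 2
    · exact hHG 1
  · simpa [Set.inter_right_comm] using havoid

end SahiTwoLevelVariational

end Summit.CriticalPhenomena.PercolationContinuityZ3.Theorems
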